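import Mathlib.MeasureTheory.Integral.Bochner.Set
import Mathlib.MeasureTheory.Measure.Lebesgue.Basic
import Literature.Probability.Process.ItoCalculus
import HarnessLib

/-!
# Algebra of bounded simple processes: refinement, differences, truncation

Bookkeeping for the bounded simple (elementary) processes `Literature.SimpleProcess m 𝓕` of
`Literature.Probability.Process.ItoCalculus` (a strictly increasing `List` of deterministic
times `t₀ < ⋯ < t_k` and bounded `𝓕 tᵢ`-measurable values on `(tᵢ, tᵢ₊₁]`), needed by every
quantitative statement about elementary stochastic integrals `SimpleProcess.integral`:

* partition-time API (`time_eq_getElem`, `time_strictMono`, `stronglyMeasurable_value`, …);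
* the summands `SimpleProcess.summand H B i r = Hᵢ (B_{r ∧ tᵢ₊₁} - B_{r ∧ tᵢ})` of the
  elementary integral (`integral_eq_sum_summand`);
* the square of a step process and its time integral
  `∫₀ᵗ H(s)² ds = ∑ᵢ Hᵢ² (t ∧ tᵢ₊₁ - t ∧ tᵢ)` (`toProcess_sq`, `setIntegral_toProcess_sq`);
* **truncation** `SimpleProcess.truncate H t η` at level `η` of the partial time integrals
  (`cumSq`) — the elementary substitute for stopping at `inf {s : ∫₀ˢ H² ≥ η}`, which keeps the
  partition deterministic: `∫₀ᵗ (H^η)² ≤ η` and `H^η = H` on `{∫₀ᵗ H² ≤ η}`;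
* **refinement** `SimpleProcess.refine H u` of the partition to a finer sorted list `u ⊇ times`
  (same step process, same elementary integrals) and the **difference** `SimpleProcess.sub H K`
  of two simple processes on the common refinement of their partitions
  (`toProcess_sub`, `integral_sub`).

All of this is deterministic (pathwise) and generic in `(Ω, 𝓕)`.

## References

* D. Revuz, M. Yor, *Continuous Martingales and Brownian Motion* (3rd ed., 1999), Ch. IV, §2,
  Def. (2.1), Thm (2.2), Def. (2.3) and the elementary stochastic integral following it,
  Prop. (2.5), Thm (2.12) ("considering subdivisions Δ including the tᵢ's").
-/

open MeasureTheory Filter Finset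
open scoped NNReal ENNReal Topology

noncomputable section

namespace Literature.Probability.Process

namespace SimpleProcess

variable {Ω : Type*} {m : MeasurableSpace Ω} {𝓕 : Filtration ℝ≥0 m}

/-! ### Bookkeeping on partition times and values -/

/-- In range, the total reading `H.time i` of the `i`-th partition time is the list entry.
Revuz–Yor, *Continuous Martingales and Brownian Motion* (1999), Ch. IV, Def. (2.3). [folklore] -/
theorem time_eq_getElem (H : SimpleProcess m 𝓕) {i : ℕ} (hi : i < H.times.length) :
    H.time i = H.times[i] := by
  rw [time, List.getD_eq_getElem?_getD, List.getElem?_eq_getElem hi, Option.getD_some]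

/-- The partition times of a simple process are strictly increasing (in range).
Revuz–Yor, *Continuous Martingales and Brownian Motion* (1999), Ch. IV, Def. (2.3). [folklore] -/
theorem time_strictMono (H : SimpleProcess m 𝓕) {i j : ℕ} (hij : i < j)
    (hj : j < H.times.length) : H.time i < H.time j := by
  rw [H.time_eq_getElem (hij.trans hj), H.time_eq_getElem hj]
  exact H.sorted.getElem_lt_getElem_of_lt hij

/-- The partition times of a simple process are nondecreasing (in range).
Revuz–Yor, *Continuous Martingales and Brownian Motion* (1999), Ch. IV, Def. (2.3). [folklore] -/
theorem time_mono (H : SimpleProcess m 𝓕) {i j : ℕ} (hij : i ≤ j) (hj : j < H.times.length) :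
    H.time i ≤ H.time j := by
  rcases hij.eq_or_lt with rfl | h
  · exact le_rfl
  · exact (H.time_strictMono h hj).le

/-- The value of a simple process on `(tᵢ, tᵢ₊₁]` is `𝓕 tᵢ`-strongly measurable (in range).
Revuz–Yor, *Continuous Martingales and Brownian Motion* (1999), Ch. IV, Def. (2.3). [folklore] -/
theorem stronglyMeasurable_value (H : SimpleProcess m 𝓕) {i : ℕ} (hi : i < H.times.length) :
    StronglyMeasurable[𝓕 (H.time i)] (H.value i) := by
  have h := H.measurable i hi
  have heq : H.times.get ⟨i, hi⟩ = H.time i := by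
    rw [H.time_eq_getElem hi]; rfl
  rwa [heq] at h

/-- In range, the values of a simple process are strongly measurable for the ambient σ-algebra.
Revuz–Yor, *Continuous Martingales and Brownian Motion* (1999), Ch. IV, Def. (2.3). [folklore] -/
theorem stronglyMeasurable_value' (H : SimpleProcess m 𝓕) {i : ℕ} (hi : i < H.times.length) :
    StronglyMeasurable (H.value i) :=
  (H.stronglyMeasurable_value hi).mono (𝓕.le _)

/-- Two distinct partition intervals `(tᵢ, tᵢ₊₁]`, `(tⱼ, tⱼ₊₁]` of a simple process are disjoint.
Revuz–Yor, *Continuous Martingales and Brownian Motion* (1999), Ch. IV, Def. (2.3). [folklore] -/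
theorem not_mem_Ioc_of_mem_Ioc (H : SimpleProcess m 𝓕) {i j : ℕ} (hi : i + 1 < H.times.length)
    (hj : j + 1 < H.times.length) (hij : i ≠ j) {t : ℝ≥0}
    (ht : t ∈ Set.Ioc (H.time j) (H.time (j + 1))) : t ∉ Set.Ioc (H.time i) (H.time (i + 1)) := by
  rintro ⟨h1, h2⟩
  rcases lt_or_gt_of_ne hij with h | h
  · exact absurd (h2.trans (H.time_mono (Nat.succ_le_of_lt h) (by omega))) (not_le.2 ht.1)
  · exact absurd (ht.2.trans (H.time_mono (Nat.succ_le_of_lt h) (by omega))) (not_le.2 h1)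

/-! ### The summands of the elementary integral -/

/-- The `i`-th summand of the elementary integral of `H` against `B` at time `r`:
`Hᵢ (B_{r ∧ tᵢ₊₁} - B_{r ∧ tᵢ})`.
Revuz–Yor, *Continuous Martingales and Brownian Motion* (1999), Ch. IV, §2, elementary
stochastic integral after Def. (2.3). [folklore] -/
def summand (H : SimpleProcess m 𝓕) (B : ℝ≥0 → Ω → ℝ) (i : ℕ) (r : ℝ≥0) : Ω → ℝ :=
  fun ω ↦ H.value i ω * (B (min r (H.time (i + 1))) ω - B (min r (H.time i)) ω)

/-- Unfolding of `summand`. [folklore] -/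
theorem summand_apply (H : SimpleProcess m 𝓕) (B : ℝ≥0 → Ω → ℝ) (i : ℕ) (r : ℝ≥0) (ω : Ω) :
    H.summand B i r ω = H.value i ω * (B (min r (H.time (i + 1))) ω - B (min r (H.time i)) ω) :=
  rfl

/-- The elementary integral is the sum of its summands (as functions of `ω`).
Revuz–Yor, *Continuous Martingales and Brownian Motion* (1999), Ch. IV, §2, after Def. (2.3).
[folklore] -/
theorem integral_eq_sum_summand (H : SimpleProcess m 𝓕) (B : ℝ≥0 → Ω → ℝ) (r : ℝ≥0) :
    H.integral B r = ∑ i ∈ range (H.times.length - 1), H.summand B i r := by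
  ext ω
  simp [SimpleProcess.integral, summand, Finset.sum_apply]

/-- The elementary integral at `ω` is the sum of its summands at `ω`. [folklore] -/
theorem integral_apply_eq_sum_summand (H : SimpleProcess m 𝓕) (B : ℝ≥0 → Ω → ℝ) (r : ℝ≥0)
    (ω : Ω) : H.integral B r ω = ∑ i ∈ range (H.times.length - 1), H.summand B i r ω := by
  rw [integral_eq_sum_summand, Finset.sum_apply]

/-- Before `tᵢ` the `i`-th summand vanishes identically (in range). [folklore] -/
theorem summand_eq_zero_of_le (H : SimpleProcess m 𝓕) (B : ℝ≥0 → Ω → ℝ) {i : ℕ}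
    (hi : i + 1 < H.times.length) {r : ℝ≥0} (hr : r ≤ H.time i) : H.summand B i r = 0 := by
  have h1 : min r (H.time (i + 1)) = r := min_eq_left (hr.trans (H.time_mono (Nat.le_succ i) hi))
  have h2 : min r (H.time i) = r := min_eq_left hr
  ext ω
  simp [summand, h1, h2]

/-- After `tᵢ` the `i`-th summand is `Hᵢ (B_{r ∧ tᵢ₊₁} - B_{tᵢ})`. [folklore] -/
theorem summand_eq_of_lt (H : SimpleProcess m 𝓕) (B : ℝ≥0 → Ω → ℝ) {i : ℕ} {r : ℝ≥0}
    (hr : H.time i < r) :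
    H.summand B i r = H.value i * (B (min r (H.time (i + 1))) - B (H.time i)) := by
  ext ω
  simp [summand, min_eq_right hr.le]

/-- Every path of an elementary integral against a process with continuous paths is
continuous. [folklore] -/
theorem continuous_integral (H : SimpleProcess m 𝓕) {B : ℝ≥0 → Ω → ℝ} {ω : Ω}
    (hB : Continuous (B · ω)) : Continuous fun r ↦ H.integral B r ω := by
  unfold SimpleProcess.integral
  refine continuous_finsetSum _ fun i _ ↦ continuous_const.mul ?_
  exact (hB.comp (continuous_id.min continuous_const)).sub
    (hB.comp (continuous_id.min continuous_const))

/-! ### The square of a step process and its time integral -/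

/-- The square of the step process of a simple process is the step process of the squared values
(the partition intervals are pairwise disjoint).
Revuz–Yor, *Continuous Martingales and Brownian Motion* (1999), Ch. IV, Def. (2.3). [folklore] -/
theorem toProcess_sq (H : SimpleProcess m 𝓕) (t : ℝ≥0) (ω : Ω) :
    H.toProcess t ω ^ 2 = ∑ i ∈ range (H.times.length - 1),
      (Set.Ioc (H.time i) (H.time (i + 1))).indicator (fun _ ↦ H.value i ω ^ 2) t := by
  unfold toProcess
  by_cases h : ∃ j ∈ range (H.times.length - 1), t ∈ Set.Ioc (H.time j) (H.time (j + 1))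
  · obtain ⟨j, hj, htj⟩ := h
    have hj' : j + 1 < H.times.length := by
      have := mem_range.1 hj; omega
    have hne : ∀ i ∈ range (H.times.length - 1), i ≠ j →
        t ∉ Set.Ioc (H.time i) (H.time (i + 1)) := fun i hi hij ↦
      H.not_mem_Ioc_of_mem_Ioc (by have := mem_range.1 hi; omega) hj' hij htj
    rw [sum_eq_single j (fun i hi hij ↦ Set.indicator_of_notMem (hne i hi hij) _)
        (fun h ↦ (h hj).elim),
      sum_eq_single j (fun i hi hij ↦ Set.indicator_of_notMem (hne i hi hij) _)
        (fun h ↦ (h hj).elim),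
      Set.indicator_of_mem htj, Set.indicator_of_mem htj]
  · push Not at h
    rw [sum_eq_zero (fun i hi ↦ Set.indicator_of_notMem (h i hi) _),
      sum_eq_zero (fun i hi ↦ Set.indicator_of_notMem (h i hi) _)]
    ring

/-- The time integral over `[0, t]` of the indicator of a partition interval `(a, b]` read at
`s⁺`: `∫_{[0,t]} 𝟙_{(a,b]}(s⁺) c ds = c (t ∧ b - t ∧ a)` for `a ≤ b`. [folklore] -/
theorem setIntegral_Icc_indicator_Ioc_toNNReal {a b : ℝ≥0} (hab : a ≤ b) (t : ℝ≥0) (c : ℝ) :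
    ∫ s in Set.Icc (0 : ℝ) t, (Set.Ioc a b).indicator (fun _ ↦ c) s.toNNReal =
      c * ((min t b : ℝ≥0) - (min t a : ℝ≥0) : ℝ) := by
  have hpre : (fun s : ℝ ↦ (Set.Ioc a b).indicator (fun _ ↦ c) s.toNNReal) =
      (Set.Ioc (a : ℝ) b).indicator fun _ ↦ c := by
    ext s
    by_cases hs : s ∈ Set.Ioc (a : ℝ) b
    · rw [Set.indicator_of_mem hs, Set.indicator_of_mem]
      exact ⟨Real.lt_toNNReal_iff_coe_lt.2 hs.1, Real.toNNReal_le_iff_le_coe.2 hs.2⟩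
    · rw [Set.indicator_of_notMem hs, Set.indicator_of_notMem]
      rintro ⟨h1, h2⟩
      exact hs ⟨Real.lt_toNNReal_iff_coe_lt.1 h1, Real.toNNReal_le_iff_le_coe.1 h2⟩
  rw [hpre, setIntegral_indicator measurableSet_Ioc, setIntegral_const, smul_eq_mul, mul_comm]
  congr 1
  have hset : Set.Icc (0 : ℝ) t ∩ Set.Ioc (a : ℝ) b = Set.Ioc (a : ℝ) (min (t : ℝ) b) := by
    ext s
    simp only [Set.mem_inter_iff, Set.mem_Icc, Set.mem_Ioc, le_min_iff]
    constructor
    · rintro ⟨⟨-, h2⟩, h3, h4⟩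
      exact ⟨h3, h2, h4⟩
    · rintro ⟨h1, h2, h3⟩
      exact ⟨⟨a.2.trans h1.le, h2⟩, h1, h3⟩
  rw [hset, Real.volume_real_Ioc, NNReal.coe_min, NNReal.coe_min]
  rcases le_or_gt t a with hta | hta
  · have htb : (t : ℝ) ≤ b := NNReal.coe_le_coe.2 (hta.trans hab)
    rw [min_eq_left htb, min_eq_left (NNReal.coe_le_coe.2 hta), sub_self,
      max_eq_right (sub_nonpos.2 (NNReal.coe_le_coe.2 hta))]
  · rw [min_eq_right (NNReal.coe_le_coe.2 hta.le), max_eq_left]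
    exact sub_nonneg.2 (le_min (NNReal.coe_le_coe.2 hta.le) (NNReal.coe_le_coe.2 hab))

/-- **Time integral of the squared step process**: pathwise,
`∫₀ᵗ H(s)² ds = ∑ᵢ Hᵢ² (t ∧ tᵢ₊₁ - t ∧ tᵢ)`.
Revuz–Yor, *Continuous Martingales and Brownian Motion* (1999), Ch. IV, Def. (2.1) (`‖K‖²_M`)
for `K ∈ ℰ`. [folklore] -/
theorem setIntegral_toProcess_sq (H : SimpleProcess m 𝓕) (t : ℝ≥0) (ω : Ω) :
    ∫ s in Set.Icc (0 : ℝ) t, (H.toProcess s.toNNReal ω) ^ 2 =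
      ∑ i ∈ range (H.times.length - 1),
        H.value i ω ^ 2 * ((min t (H.time (i + 1)) : ℝ≥0) - (min t (H.time i) : ℝ≥0) : ℝ) := by
  simp_rw [toProcess_sq]
  rw [integral_finsetSum]
  · refine sum_congr rfl fun i hi ↦ ?_
    have hi' : i + 1 < H.times.length := by have := mem_range.1 hi; omega
    exact setIntegral_Icc_indicator_Ioc_toNNReal (H.time_mono (Nat.le_succ i) hi') t _
  · intro i hi
    have hmeas : Measurable fun s : ℝ ↦
        (Set.Ioc (H.time i) (H.time (i + 1))).indicator (fun _ ↦ H.value i ω ^ 2) s.toNNReal :=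
      (measurable_const.indicator measurableSet_Ioc).comp measurable_real_toNNReal
    refine ⟨hmeas.aestronglyMeasurable, ?_⟩
    refine HasFiniteIntegral.of_bounded (C := |H.value i ω ^ 2|) (ae_of_all _ fun s ↦ ?_)
    simp only [Real.norm_eq_abs]
    by_cases hs : s.toNNReal ∈ Set.Ioc (H.time i) (H.time (i + 1))
    · rw [Set.indicator_of_mem hs]
    · rw [Set.indicator_of_notMem hs, abs_zero]
      exact abs_nonneg _


/-! ### Truncation of a simple process at a level of its time integral -/

/-- The partial sums `Sᵢ(ω) = ∑_{j ≤ i} Hⱼ(ω)² (t ∧ tⱼ₊₁ - t ∧ tⱼ)` of the time integral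
`∫₀ᵗ H(s)² ds` of a simple process over its first `i + 1` partition intervals
(cf. `setIntegral_toProcess_sq`). `Sᵢ` is `𝓕 tᵢ`-measurable, which makes the truncated process
`truncate` adapted.
Revuz–Yor, *Continuous Martingales and Brownian Motion* (1999), Ch. IV, Prop. (2.5) and
Thm (2.12) (localisation of stochastic integrals). [folklore] -/
def cumSq (H : SimpleProcess m 𝓕) (t : ℝ≥0) (i : ℕ) (ω : Ω) : ℝ :=
  ∑ j ∈ range (i + 1),
    H.value j ω ^ 2 * ((min t (H.time (j + 1)) : ℝ≥0) - (min t (H.time j) : ℝ≥0) : ℝ)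

/-- The increments of the time integral over partition intervals are nonnegative (in range).
[folklore] -/
theorem sq_mul_sub_nonneg (H : SimpleProcess m 𝓕) (t : ℝ≥0) {j : ℕ} (hj : j + 1 < H.times.length)
    (ω : Ω) :
    0 ≤ H.value j ω ^ 2 * ((min t (H.time (j + 1)) : ℝ≥0) - (min t (H.time j) : ℝ≥0) : ℝ) :=
  mul_nonneg (sq_nonneg _) (sub_nonneg.2 (NNReal.coe_le_coe.2
    (min_le_min_left _ (H.time_mono (Nat.le_succ j) hj))))

/-- The partial sums `cumSq` are nondecreasing in the number of intervals (in range). [folklore] -/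
theorem cumSq_mono (H : SimpleProcess m 𝓕) (t : ℝ≥0) {i k : ℕ} (hik : i ≤ k)
    (hk : k + 1 < H.times.length) (ω : Ω) : H.cumSq t i ω ≤ H.cumSq t k ω := by
  unfold cumSq
  rw [← sum_range_add_sum_Ico _ (Nat.succ_le_succ hik)]
  refine le_add_of_nonneg_right (sum_nonneg fun j hj ↦ ?_)
  have := (mem_Ico.1 hj).2
  exact H.sq_mul_sub_nonneg t (by omega) ω

/-- The last partial sum is the whole time integral `∫₀ᵗ H(s)² ds` (for at least two partition
times). [folklore] -/
theorem cumSq_length_sub_two (H : SimpleProcess m 𝓕) (t : ℝ≥0) (h2 : 2 ≤ H.times.length)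
    (ω : Ω) :
    H.cumSq t (H.times.length - 2) ω = ∫ s in Set.Icc (0 : ℝ) t, (H.toProcess s.toNNReal ω) ^ 2 := by
  rw [setIntegral_toProcess_sq, cumSq]
  congr 1
  congr 1
  omega

/-- `cumSq H t i` is `𝓕 tᵢ`-strongly measurable (for `i` in range). [folklore] -/
theorem stronglyMeasurable_cumSq (H : SimpleProcess m 𝓕) (t : ℝ≥0) {i : ℕ}
    (hi : i < H.times.length) : StronglyMeasurable[𝓕 (H.time i)] (H.cumSq t i) := by
  unfold cumSq
  refine Finset.stronglyMeasurable_fun_sum _ fun j hj ↦ ?_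
  have hji : j ≤ i := Nat.lt_succ_iff.1 (mem_range.1 hj)
  exact (((H.stronglyMeasurable_value (hji.trans_lt hi)).mono
    (𝓕.mono (H.time_mono hji hi))).pow 2).mul stronglyMeasurable_const

/-- **Truncation of a simple process at level `η` of its time integral on `[0, t]`**: the simple
process with the same partition times whose value on `(tᵢ, tᵢ₊₁]` is `Hᵢ` if the partial time
integral `Sᵢ = ∑_{j ≤ i} Hⱼ² (t ∧ tⱼ₊₁ - t ∧ tⱼ)` is `≤ η` and `0` otherwise — the elementary
counterpart of stopping `H` at the first time `∫₀ H² ds` exceeds `η`. It is adapted because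
`Sᵢ` is `𝓕 tᵢ`-measurable, satisfies `∫₀ᵗ (H^η)² ds ≤ η` (`setIntegral_toProcess_truncate_sq_le`)
and coincides with `H` on `{∫₀ᵗ H² ds ≤ η}` (`truncate_value_eq`).
Revuz–Yor, *Continuous Martingales and Brownian Motion* (1999), Ch. IV, Prop. (2.5)
(`K 1_{[0,T]} · M = (K · M)^T`) and Thm (2.12). [folklore] -/
def truncate (H : SimpleProcess m 𝓕) (t : ℝ≥0) (η : ℝ) : SimpleProcess m 𝓕 where
  times := H.times
  sorted := H.sorted
  value i := {ω | H.cumSq t i ω ≤ η}.indicator (H.value i)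
  measurable i hi := by
    have heq : H.times.get ⟨i, hi⟩ = H.time i := by
      rw [H.time_eq_getElem hi]; rfl
    rw [heq]
    refine (H.stronglyMeasurable_value hi).indicator ?_
    exact (H.stronglyMeasurable_cumSq t hi).measurable measurableSet_Iic
  bounded := by
    obtain ⟨C, hC⟩ := H.bounded
    refine ⟨C, fun i ω ↦ ?_⟩
    by_cases h : ω ∈ {ω | H.cumSq t i ω ≤ η}
    · rw [Set.indicator_of_mem h]; exact hC i ω
    · rw [Set.indicator_of_notMem h, abs_zero]; exact (abs_nonneg _).trans (hC i ω)

/-- Truncation keeps the partition times. [folklore] -/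
@[simp] theorem truncate_times (H : SimpleProcess m 𝓕) (t : ℝ≥0) (η : ℝ) :
    (H.truncate t η).times = H.times := rfl

/-- Truncation keeps the partition times (total reading). [folklore] -/
@[simp] theorem truncate_time (H : SimpleProcess m 𝓕) (t : ℝ≥0) (η : ℝ) (i : ℕ) :
    (H.truncate t η).time i = H.time i := rfl

/-- Unfolding of the values of the truncated process. [folklore] -/
theorem truncate_value (H : SimpleProcess m 𝓕) (t : ℝ≥0) (η : ℝ) (i : ℕ) :
    (H.truncate t η).value i = {ω | H.cumSq t i ω ≤ η}.indicator (H.value i) := rfl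

/-- On the event `{∫₀ᵗ H² ds ≤ η}` the truncation does nothing (all partial sums are `≤ η`).
[folklore] -/
theorem truncate_value_eq (H : SimpleProcess m 𝓕) (t : ℝ≥0) (η : ℝ) {i : ℕ}
    (hi : i + 1 < H.times.length) {ω : Ω}
    (hω : ∫ s in Set.Icc (0 : ℝ) t, (H.toProcess s.toNNReal ω) ^ 2 ≤ η) :
    (H.truncate t η).value i ω = H.value i ω := by
  rw [truncate_value, Set.indicator_of_mem]
  show H.cumSq t i ω ≤ η
  rw [← H.cumSq_length_sub_two t (by omega)] at hω
  exact (H.cumSq_mono t (by omega) (by omega) ω).trans hω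

/-- On `{∫₀ᵗ H² ds ≤ η}` the truncated process has the same elementary integrals as `H`.
[folklore] -/
theorem integral_truncate_eq (H : SimpleProcess m 𝓕) (t : ℝ≥0) (η : ℝ) (B : ℝ≥0 → Ω → ℝ)
    {ω : Ω} (hω : ∫ s in Set.Icc (0 : ℝ) t, (H.toProcess s.toNNReal ω) ^ 2 ≤ η) (r : ℝ≥0) :
    (H.truncate t η).integral B r ω = H.integral B r ω := by
  unfold integral
  simp only [truncate_times, truncate_time]
  refine sum_congr rfl fun i hi ↦ ?_
  rw [H.truncate_value_eq t η (by have := mem_range.1 hi; omega) hω]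

/-- **The truncated process has time integral at most `η`** on `[0, t]` (for `η ≥ 0`):
`∫₀ᵗ (H^η)² ds = ∑_{i : Sᵢ ≤ η} (Sᵢ - Sᵢ₋₁) ≤ η`. [folklore] -/
theorem setIntegral_toProcess_truncate_sq_le (H : SimpleProcess m 𝓕) (t : ℝ≥0) {η : ℝ}
    (hη : 0 ≤ η) (ω : Ω) :
    ∫ s in Set.Icc (0 : ℝ) t, ((H.truncate t η).toProcess s.toNNReal ω) ^ 2 ≤ η := by
  rw [setIntegral_toProcess_sq]
  simp only [truncate_times, truncate_time, truncate_value]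
  -- the summands, with the truncation indicator pulled out
  set a : ℕ → ℝ := fun j ↦
    H.value j ω ^ 2 * ((min t (H.time (j + 1)) : ℝ≥0) - (min t (H.time j) : ℝ≥0) : ℝ) with ha
  have hS : ∀ i, H.cumSq t i ω = ∑ j ∈ range (i + 1), a j := fun i ↦ rfl
  have hterm : ∀ i, ({ω | H.cumSq t i ω ≤ η}.indicator (H.value i) ω) ^ 2 *
      ((min t (H.time (i + 1)) : ℝ≥0) - (min t (H.time i) : ℝ≥0) : ℝ) =
      if H.cumSq t i ω ≤ η then a i else 0 := by
    intro i
    by_cases h : H.cumSq t i ω ≤ η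
    · rw [Set.indicator_of_mem (show ω ∈ {ω | H.cumSq t i ω ≤ η} from h), if_pos h]
    · rw [Set.indicator_of_notMem (show ω ∉ {ω | H.cumSq t i ω ≤ η} from h), if_neg h]
      simp
  simp_rw [hterm]
  -- claim by induction on the number `n ≤ length - 1` of intervals
  suffices ∀ n, n ≤ H.times.length - 1 →
      ∑ i ∈ range n, (if H.cumSq t i ω ≤ η then a i else 0) ≤ η from this _ le_rfl
  intro n
  induction n with
  | zero => intro _; simp [hη]
  | succ n ih =>
    intro hn
    rw [sum_range_succ]
    by_cases h : H.cumSq t n ω ≤ η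
    · -- all earlier partial sums are `≤ η` too, so the sum is the full partial sum `Sₙ ≤ η`
      rw [if_pos h]
      have hall : ∀ i ∈ range n, (if H.cumSq t i ω ≤ η then a i else 0) = a i := by
        intro i hi
        rw [if_pos]
        exact (H.cumSq_mono t (mem_range.1 hi).le (by omega) ω).trans h
      rw [sum_congr rfl hall, ← sum_range_succ, ← hS]
      exact h
    · rw [if_neg h, add_zero]
      exact ih (by omega)

/-! ### Order bookkeeping on partition times -/

/-- Partition times compare like their indices (strict). [folklore] -/
theorem time_lt_time_iff (H : SimpleProcess m 𝓕) {p q : ℕ} (hp : p < H.times.length)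
    (hq : q < H.times.length) : H.time p < H.time q ↔ p < q := by
  rw [H.time_eq_getElem hp, H.time_eq_getElem hq]
  exact (H.sorted.lt_iff_lt (a := ⟨p, hp⟩) (b := ⟨q, hq⟩))

/-- Partition times compare like their indices. [folklore] -/
theorem time_le_time_iff (H : SimpleProcess m 𝓕) {p q : ℕ} (hp : p < H.times.length)
    (hq : q < H.times.length) : H.time p ≤ H.time q ↔ p ≤ q := by
  rw [H.time_eq_getElem hp, H.time_eq_getElem hq]
  exact (H.sorted.le_iff_le (a := ⟨p, hp⟩) (b := ⟨q, hq⟩))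

/-- A partition time is one of the `H.time p`, `p` in range. [folklore] -/
theorem exists_time_eq_of_mem (H : SimpleProcess m 𝓕) {x : ℝ≥0} (hx : x ∈ H.times) :
    ∃ p, p < H.times.length ∧ H.time p = x := by
  obtain ⟨p, hp, rfl⟩ := List.mem_iff_getElem.1 hx
  exact ⟨p, hp, H.time_eq_getElem hp⟩

/-- Partition times (in range) are members of the list of times. [folklore] -/
theorem time_mem (H : SimpleProcess m 𝓕) {i : ℕ} (hi : i < H.times.length) : H.time i ∈ H.times := by
  rw [H.time_eq_getElem hi]
  exact List.getElem_mem hi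

/-- **Locating a time in the partition**: if `t_p < s ≤ t_q` then `s ∈ (t_j, t_{j+1}]` for some
`p ≤ j < q`. [folklore] -/
theorem exists_mem_Ioc_time (H : SimpleProcess m 𝓕) {s : ℝ≥0} {p q : ℕ} (hq : q < H.times.length)
    (hpq : p < q) (hs : s ∈ Set.Ioc (H.time p) (H.time q)) :
    ∃ j, p ≤ j ∧ j < q ∧ s ∈ Set.Ioc (H.time j) (H.time (j + 1)) := by
  induction q with
  | zero => exact absurd hpq (Nat.not_lt_zero p)
  | succ q ih =>
    by_cases h : H.time q < s
    · exact ⟨q, Nat.lt_succ_iff.1 hpq, Nat.lt_succ_self q, h, hs.2⟩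
    · push Not at h
      have hpq' : p < q := by
        rcases (Nat.lt_succ_iff.1 hpq).eq_or_lt with rfl | h'
        · exact absurd (hs.1.trans_le h) (lt_irrefl _)
        · exact h'
      obtain ⟨j, hpj, hjq, hj⟩ := ih (by omega) hpq' ⟨hs.1, h⟩
      exact ⟨j, hpj, hjq.trans (Nat.lt_succ_self q), hj⟩

/-- The step process is bounded by the bound on the values (at most one interval is active).
[folklore] -/
theorem abs_toProcess_le (H : SimpleProcess m 𝓕) {C : ℝ} (hC : ∀ i ω, |H.value i ω| ≤ C)
    (x : ℝ≥0) (ω : Ω) : |H.toProcess x ω| ≤ max C 0 := by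
  unfold toProcess
  by_cases h : ∃ j ∈ range (H.times.length - 1), x ∈ Set.Ioc (H.time j) (H.time (j + 1))
  · obtain ⟨j, hj, hxj⟩ := h
    have hj' : j + 1 < H.times.length := by have := mem_range.1 hj; omega
    rw [sum_eq_single j (fun i hi hij ↦ Set.indicator_of_notMem
        (H.not_mem_Ioc_of_mem_Ioc (by have := mem_range.1 hi; omega) hj' hij hxj) _)
        (fun h ↦ (h hj).elim), Set.indicator_of_mem hxj]
    exact (hC j ω).trans (le_max_left _ _)
  · push Not at h
    rw [sum_eq_zero (fun i hi ↦ Set.indicator_of_notMem (h i hi) _), abs_zero]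
    exact le_max_right _ _

/-- The step process vanishes at time `0`. [folklore] -/
theorem toProcess_zero (H : SimpleProcess m 𝓕) (ω : Ω) : H.toProcess 0 ω = 0 := by
  unfold toProcess
  exact sum_eq_zero fun i _ ↦ Set.indicator_of_notMem (fun h ↦ not_lt_zero h.1) _

/-- The step process read at a fixed time `x` is `𝓕 u`-strongly measurable as soon as every
partition time `< x` is `≤ u` (only the interval containing `x` contributes). [folklore] -/
theorem stronglyMeasurable_toProcess_of_forall (H : SimpleProcess m 𝓕) (x u : ℝ≥0)
    (hu : ∀ p, p < H.times.length → H.time p < x → H.time p ≤ u) :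
    StronglyMeasurable[𝓕 u] (fun ω ↦ H.toProcess x ω) := by
  unfold toProcess
  refine Finset.stronglyMeasurable_fun_sum _ fun i hi ↦ ?_
  have hi' : i < H.times.length := by have := mem_range.1 hi; omega
  by_cases hx : x ∈ Set.Ioc (H.time i) (H.time (i + 1))
  · simp only [Set.indicator_of_mem hx]
    exact (H.stronglyMeasurable_value hi').mono (𝓕.mono (hu i hi' hx.1))
  · simp only [Set.indicator_of_notMem hx]
    exact stronglyMeasurable_const

/-! ### Refinement of the partition -/

section Refine

variable (H : SimpleProcess m 𝓕) (u : List ℝ≥0) (hu : u.SortedLT) (hsub : H.times ⊆ u)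

/-- **Refinement of a simple process to a finer partition**: given a strictly increasing list
`u` of times containing all partition times of `H`, the simple process with partition `u` whose
value on `(uⱼ, uⱼ₊₁]` is the (constant) value of the step process of `H` there, read at the
right end point `uⱼ₊₁`. It has the same step process (`toProcess_refine`) and the same
elementary integrals (`integral_refine`).
Revuz–Yor, *Continuous Martingales and Brownian Motion* (1999), Ch. IV, §2, after Def. (2.3)
("considering subdivisions `Δ` including the `tᵢ`'s"). [folklore] -/
def refine : SimpleProcess m 𝓕 where
  times := u
  sorted := hu
  value j := fun ω ↦ H.toProcess (u.getD (j + 1) 0) ω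
  measurable j hj := by
    -- every partition time of `H` below `u_{j+1}` is `≤ u_j`
    refine H.stronglyMeasurable_toProcess_of_forall _ _ fun p hp hpx ↦ ?_
    obtain ⟨k, hk, hk'⟩ := List.mem_iff_getElem.1 (hsub (H.time_mem hp))
    by_cases hj1 : j + 1 < u.length
    · rw [List.getD_eq_getElem?_getD, List.getElem?_eq_getElem hj1, Option.getD_some] at hpx
      rw [← hk'] at hpx ⊢
      have hkj : k < j + 1 := (hu.lt_iff_lt (a := ⟨k, hk⟩) (b := ⟨j + 1, hj1⟩)).1 hpx
      exact (hu.le_iff_le (a := ⟨k, hk⟩) (b := ⟨j, hj⟩)).2 (Nat.lt_succ_iff.1 hkj)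
    · rw [List.getD_eq_getElem?_getD, List.getElem?_eq_none (by omega), Option.getD_none] at hpx
      exact absurd hpx (not_lt_zero)
  bounded := by
    obtain ⟨C, hC⟩ := H.bounded
    exact ⟨max C 0, fun j ω ↦ H.abs_toProcess_le hC _ ω⟩

/-- The refined process has the prescribed partition. [folklore] -/
@[simp] theorem refine_times : (H.refine u hu hsub).times = u := rfl

/-- Unfolding of the values of the refined process. [folklore] -/
theorem refine_value (j : ℕ) (ω : Ω) :
    (H.refine u hu hsub).value j ω = H.toProcess ((H.refine u hu hsub).time (j + 1)) ω := rfl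

/-- Membership in an original partition interval is decided by the right end point of the
refined interval: for `s ∈ (uⱼ, uⱼ₊₁]`, `s ∈ (tᵢ, tᵢ₊₁] ↔ uⱼ₊₁ ∈ (tᵢ, tᵢ₊₁]`. [folklore] -/
theorem mem_Ioc_iff_of_mem_Ioc_refine {s : ℝ≥0} {j : ℕ} (hj : j + 1 < u.length)
    (hs : s ∈ Set.Ioc ((H.refine u hu hsub).time j) ((H.refine u hu hsub).time (j + 1)))
    {i : ℕ} (hi : i + 1 < H.times.length) :
    s ∈ Set.Ioc (H.time i) (H.time (i + 1)) ↔
      (H.refine u hu hsub).time (j + 1) ∈ Set.Ioc (H.time i) (H.time (i + 1)) := by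
  set R := H.refine u hu hsub with hR
  obtain ⟨p, hp, hpi⟩ := R.exists_time_eq_of_mem (hsub (H.time_mem (by omega)) : H.time i ∈ u)
  obtain ⟨q, hq, hqi⟩ := R.exists_time_eq_of_mem (hsub (H.time_mem hi) : H.time (i + 1) ∈ u)
  have hlen : R.times.length = u.length := rfl
  rw [hlen] at hp hq
  rw [← hpi, ← hqi]
  constructor
  · rintro ⟨h1, h2⟩
    refine ⟨h1.trans_le hs.2, ?_⟩
    rw [R.time_le_time_iff hj hq]
    by_contra hcon
    push Not at hcon
    have : R.time q ≤ R.time j := (R.time_le_time_iff hq (by omega)).2 (Nat.lt_succ_iff.1 hcon)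
    exact absurd (this.trans_lt (hs.1.trans_le h2)) (lt_irrefl _)
  · rintro ⟨h1, h2⟩
    refine ⟨?_, hs.2.trans h2⟩
    have hpj : p ≤ j := Nat.lt_succ_iff.1 ((R.time_lt_time_iff hp hj).1 h1)
    exact ((R.time_le_time_iff hp (by omega)).2 hpj).trans_lt hs.1

/-- **Refinement does not change the step process.** [folklore] -/
theorem toProcess_refine (s : ℝ≥0) (ω : Ω) :
    (H.refine u hu hsub).toProcess s ω = H.toProcess s ω := by
  set R := H.refine u hu hsub with hR
  have hlen : R.times.length = u.length := rfl
  by_cases h : ∃ j ∈ range (u.length - 1), s ∈ Set.Ioc (R.time j) (R.time (j + 1))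
  · obtain ⟨j, hj, hsj⟩ := h
    have hj' : j + 1 < u.length := by have := mem_range.1 hj; omega
    -- the refined step process at `s` is the value on `(u_j, u_{j+1}]`
    have hL : R.toProcess s ω = H.toProcess (R.time (j + 1)) ω := by
      unfold toProcess
      rw [hlen, sum_eq_single j (fun i hi hij ↦ Set.indicator_of_notMem
          (R.not_mem_Ioc_of_mem_Ioc (by have := mem_range.1 hi; rw [hlen]; omega)
            (by rw [hlen]; exact hj') hij hsj) _) (fun h ↦ (h hj).elim),
        Set.indicator_of_mem hsj]
      rfl
    rw [hL]
    unfold toProcess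
    refine sum_congr rfl fun i hi ↦ ?_
    have hi' : i + 1 < H.times.length := by have := mem_range.1 hi; omega
    by_cases hsi : s ∈ Set.Ioc (H.time i) (H.time (i + 1))
    · rw [Set.indicator_of_mem hsi, Set.indicator_of_mem]
      exact (H.mem_Ioc_iff_of_mem_Ioc_refine u hu hsub hj' hsj hi').1 hsi
    · rw [Set.indicator_of_notMem hsi, Set.indicator_of_notMem]
      exact fun h' ↦ hsi ((H.mem_Ioc_iff_of_mem_Ioc_refine u hu hsub hj' hsj hi').2 h')
  · -- `s` lies in no refined interval, hence in no original one
    push Not at h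
    have hL : R.toProcess s ω = 0 := by
      unfold toProcess
      rw [hlen]
      exact sum_eq_zero fun i hi ↦ Set.indicator_of_notMem (h i hi) _
    rw [hL]
    unfold toProcess
    symm
    refine sum_eq_zero fun i hi ↦ Set.indicator_of_notMem (fun hsi ↦ ?_) _
    have hi' : i + 1 < H.times.length := by have := mem_range.1 hi; omega
    obtain ⟨p, hp, hpi⟩ :=
      R.exists_time_eq_of_mem (hsub (H.time_mem (by omega)) : H.time i ∈ u)
    obtain ⟨q, hq, hqi⟩ :=
      R.exists_time_eq_of_mem (hsub (H.time_mem hi') : H.time (i + 1) ∈ u)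
    rw [hlen] at hp hq
    rw [← hpi, ← hqi] at hsi
    have hpq : p < q := (R.time_lt_time_iff hp hq).1 (hsi.1.trans_le hsi.2)
    obtain ⟨j, -, hjq, hj⟩ := R.exists_mem_Ioc_time hq hpq hsi
    exact h j (mem_range.2 (by omega)) hj

/-- **Refinement does not change elementary integrals** (telescoping over the refined
intervals inside each original interval). [folklore] -/
theorem integral_refine (B : ℝ≥0 → Ω → ℝ) (r : ℝ≥0) (ω : Ω) :
    (H.refine u hu hsub).integral B r ω = H.integral B r ω := by
  set R := H.refine u hu hsub with hR
  have hlen : R.times.length = u.length := rfl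
  -- expand the refined values into the original ones and swap the sums
  have hval : ∀ j, R.value j ω = ∑ i ∈ range (H.times.length - 1),
      (Set.Ioc (H.time i) (H.time (i + 1))).indicator (fun _ ↦ H.value i ω) (R.time (j + 1)) :=
    fun j ↦ rfl
  unfold integral
  simp_rw [hval, sum_mul]
  rw [sum_comm]
  refine sum_congr rfl fun i hi ↦ ?_
  have hi' : i + 1 < H.times.length := by have := mem_range.1 hi; omega
  -- indices of `tᵢ`, `tᵢ₊₁` in the refined partition
  obtain ⟨p, hp, hpi⟩ :=
    R.exists_time_eq_of_mem (hsub (H.time_mem (by omega)) : H.time i ∈ u)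
  obtain ⟨q, hq, hqi⟩ :=
    R.exists_time_eq_of_mem (hsub (H.time_mem hi') : H.time (i + 1) ∈ u)
  rw [hlen] at hp hq
  have hpq : p < q := (R.time_lt_time_iff hp hq).1 (by
    rw [hpi, hqi]; exact H.time_strictMono (Nat.lt_succ_self i) hi')
  -- the refined intervals inside `(tᵢ, tᵢ₊₁]` are exactly `j ∈ [p, q)`
  have hiff : ∀ j ∈ range (R.times.length - 1),
      (R.time (j + 1) ∈ Set.Ioc (H.time i) (H.time (i + 1)) ↔ j ∈ Ico p q) := by
    intro j hj
    have hj' : j + 1 < u.length := by have := mem_range.1 hj; rw [hlen] at this; omega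
    rw [← hpi, ← hqi, mem_Ico, Set.mem_Ioc, R.time_lt_time_iff hp hj', R.time_le_time_iff hj' hq,
      Nat.lt_succ_iff, Nat.succ_le_iff]
  calc ∑ j ∈ range (R.times.length - 1),
        (Set.Ioc (H.time i) (H.time (i + 1))).indicator (fun _ ↦ H.value i ω) (R.time (j + 1)) *
          (B (min r (R.time (j + 1))) ω - B (min r (R.time j)) ω)
      = ∑ j ∈ range (R.times.length - 1), if j ∈ Ico p q then
          H.value i ω * (B (min r (R.time (j + 1))) ω - B (min r (R.time j)) ω) else 0 := by
        refine sum_congr rfl fun j hj ↦ ?_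
        by_cases hmem : R.time (j + 1) ∈ Set.Ioc (H.time i) (H.time (i + 1))
        · rw [Set.indicator_of_mem hmem, if_pos ((hiff j hj).1 hmem)]
        · rw [Set.indicator_of_notMem hmem, if_neg (fun h' ↦ hmem ((hiff j hj).2 h')), zero_mul]
    _ = ∑ j ∈ Ico p q, H.value i ω * (B (min r (R.time (j + 1))) ω - B (min r (R.time j)) ω) := by
        rw [← sum_filter]
        congr 1
        ext j
        simp only [mem_filter, mem_range, mem_Ico]
        constructor
        · exact fun h ↦ h.2
        · exact fun h ↦ ⟨by rw [hlen]; omega, h⟩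
    _ = H.value i ω * (B (min r (H.time (i + 1))) ω - B (min r (H.time i)) ω) := by
        rw [← mul_sum, sum_Ico_eq_sum_range]
        congr 1
        have := sum_range_sub (fun k ↦ B (min r (R.time (p + k))) ω) (q - p)
        simp only [← add_assoc] at this
        rw [this, Nat.add_sub_cancel' hpq.le, add_zero, hpi, hqi]

end Refine

/-! ### Differences of simple processes -/

section Sub

variable (H K : SimpleProcess m 𝓕)

/-- The common refinement of the partitions of two simple processes: the sorted list of all
their partition times. [folklore] -/
def commonTimes : List ℝ≥0 := ((H.times ++ K.times).toFinset).sort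

/-- The common refinement is strictly sorted. [folklore] -/
theorem sortedLT_commonTimes : (H.commonTimes K).SortedLT := Finset.sortedLT_sort _

/-- The common refinement contains the partition of the first process. [folklore] -/
theorem subset_commonTimes_left : H.times ⊆ H.commonTimes K := fun x hx ↦ by
  rw [commonTimes, Finset.mem_sort, List.mem_toFinset]
  exact List.mem_append_left _ hx

/-- The common refinement contains the partition of the second process. [folklore] -/
theorem subset_commonTimes_right : K.times ⊆ H.commonTimes K := fun x hx ↦ by
  rw [commonTimes, Finset.mem_sort, List.mem_toFinset]
  exact List.mem_append_right _ hx

/-- **Difference of two bounded simple processes**, as a bounded simple process on the common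
refinement of their partitions: `(H - K)ⱼ = Hⱼ' - Kⱼ'` with `H', K'` the refinements of `H, K`.
Its step process is `H - K` (`toProcess_sub`) and its elementary integrals are the differences
of those of `H` and `K` (`integral_sub`).
Revuz–Yor, *Continuous Martingales and Brownian Motion* (1999), Ch. IV, §2, after Def. (2.3)
(the elementary processes form a vector space `ℰ`). [folklore] -/
def sub : SimpleProcess m 𝓕 where
  times := H.commonTimes K
  sorted := H.sortedLT_commonTimes K
  value j ω :=
    (H.refine _ (H.sortedLT_commonTimes K) (H.subset_commonTimes_left K)).value j ω -
      (K.refine _ (H.sortedLT_commonTimes K) (H.subset_commonTimes_right K)).value j ω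
  measurable j hj :=
    ((H.refine _ (H.sortedLT_commonTimes K) (H.subset_commonTimes_left K)).measurable j hj).sub
      ((K.refine _ (H.sortedLT_commonTimes K) (H.subset_commonTimes_right K)).measurable j hj)
  bounded := by
    obtain ⟨C, hC⟩ := (H.refine _ (H.sortedLT_commonTimes K) (H.subset_commonTimes_left K)).bounded
    obtain ⟨C', hC'⟩ :=
      (K.refine _ (H.sortedLT_commonTimes K) (H.subset_commonTimes_right K)).bounded
    exact ⟨C + C', fun j ω ↦ (abs_sub _ _).trans (add_le_add (hC j ω) (hC' j ω))⟩

/-- The step process of the difference is the difference of the step processes. [folklore] -/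
theorem toProcess_sub (s : ℝ≥0) (ω : Ω) :
    (H.sub K).toProcess s ω = H.toProcess s ω - K.toProcess s ω := by
  rw [← H.toProcess_refine _ (H.sortedLT_commonTimes K) (H.subset_commonTimes_left K) s ω,
    ← K.toProcess_refine _ (H.sortedLT_commonTimes K) (H.subset_commonTimes_right K) s ω]
  set RH := H.refine _ (H.sortedLT_commonTimes K) (H.subset_commonTimes_left K) with hRH
  set RK := K.refine _ (H.sortedLT_commonTimes K) (H.subset_commonTimes_right K) with hRK
  have h1 : ∀ i, (H.sub K).time i = RH.time i := fun i ↦ rfl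
  have h2 : ∀ i, RK.time i = RH.time i := fun i ↦ rfl
  have h3 : (H.sub K).times.length = RH.times.length := rfl
  have h4 : RK.times.length = RH.times.length := rfl
  have h5 : ∀ i ω, (H.sub K).value i ω = RH.value i ω - RK.value i ω := fun i ω ↦ rfl
  unfold toProcess
  simp only [h1, h2, h3, h4, h5]
  rw [← sum_sub_distrib]
  refine sum_congr rfl fun j _ ↦ ?_
  by_cases hs : s ∈ Set.Ioc (RH.time j) (RH.time (j + 1))
  · simp only [Set.indicator_of_mem hs]
  · simp only [Set.indicator_of_notMem hs, sub_zero]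

/-- The elementary integral of the difference is the difference of the elementary integrals.
[folklore] -/
theorem integral_sub (B : ℝ≥0 → Ω → ℝ) (r : ℝ≥0) (ω : Ω) :
    (H.sub K).integral B r ω = H.integral B r ω - K.integral B r ω := by
  rw [← H.integral_refine _ (H.sortedLT_commonTimes K) (H.subset_commonTimes_left K) B r ω,
    ← K.integral_refine _ (H.sortedLT_commonTimes K) (H.subset_commonTimes_right K) B r ω]
  set RH := H.refine _ (H.sortedLT_commonTimes K) (H.subset_commonTimes_left K) with hRH
  set RK := K.refine _ (H.sortedLT_commonTimes K) (H.subset_commonTimes_right K) with hRK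
  have h1 : ∀ i, (H.sub K).time i = RH.time i := fun i ↦ rfl
  have h2 : ∀ i, RK.time i = RH.time i := fun i ↦ rfl
  have h3 : (H.sub K).times.length = RH.times.length := rfl
  have h4 : RK.times.length = RH.times.length := rfl
  have h5 : ∀ i ω, (H.sub K).value i ω = RH.value i ω - RK.value i ω := fun i ω ↦ rfl
  unfold integral
  simp only [h1, h2, h3, h4, h5]
  rw [← sum_sub_distrib]
  refine sum_congr rfl fun j _ ↦ ?_
  ring

end Sub

end SimpleProcess

end Literature.Probability.Process
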